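import Mathlib
import HarnessLib
import Summits.Ventures.LatticeQCDFlow.Scoring.ReversibleKernelTauIntFloor
import Summits.Ventures.LatticeQCDFlow.Scaling.SimulatedTemperingWithinLevel

/-!
# TIME REVERSAL DOES NOT CHANGE AUTOCORRELATIONS: a Markov kernel and its `π`-adjoint have the same autocovariance function, `τ_int` and Dirichlet form for EVERY observable; the additive reversibilization `½(κ + κ†)` is a reversible kernel with that same Dirichlet form

HONEST FRAMING: exact (Metropolis-corrected) sampling algorithms for lattice gauge theory;
figures of merit are autocorrelation/cost numbers at stated couplings and volumes; no
continuum-physics claim.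

Venture `LatticeQCDFlow` (cell pub-lqcd), topic `Scoring`; FANOUT row 8 (`s0-cpn-nemc`, GEN-24).
NEW WORK of the cell over Mathlib's kernel library and the cell's vocabulary: `kop κ` / `autocov κ π`
(`Scoring/KernelTransitionOperator`), `IsAdjointPair κ κ' π` with its functional form and
`isAdjointPair_cycle_reverse` (row 9, `Exactness/AdjointKernels`: the REVERSED sweep is the `π`-adjoint
of the forward sweep on any measurable state space), `integral_kop_mul_comm_of_isReversible`
(`Scoring/ReversibleKernelTauIntFloor`), `mixtureKernel t κ η` (`Scaling/SimulatedTemperingWithinLevel`).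
Elementary (Fubini for the composition product); nothing is cited as a fact.  Printed counterparts
NAMED ONLY: Neal 1996/2004 ("mutually reversible" kernels), Fill 1991 and Bierkens 2016 (additive
reversibilization `½(P + P̃)`).

## Why (rows 8 / 9 / 21 / 22: ordered sweeps, NE-MCMC forward/reverse protocols, PTBC ladders)

A production sweep of reversible local updates in a FIXED order is not reversible; its time reversal
is the sweep in the opposite order (`isAdjointPair_cycle_reverse`).  For the SCORING of a run only
single-observable autocovariances enter (`C_g(t)`, `ρ_g(t)`, `τ_int`, `Γ`-windows, Green–Kubo sums), and
these are IDENTICAL for a kernel and its adjoint: `∫ g (κᵗ g) dπ = ∫ (κ†)ᵗ g · g dπ`.  So every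
autocorrelation floor / ceiling / certificate the tree proves for one sweep direction holds verbatim
for the other, and "forward vs backward" is never a lever.  The quadratic (Dirichlet) forms also agree
(`t = 1`), and the fair mixture `½(κ + κ†)` — a genuine Mathlib kernel on the general state space — is
`π`-REVERSIBLE with the SAME Dirichlet form: it is the comparison partner for the non-reversible
Dirichlet-form comparison of `Exactness/NonreversibleDirichletComparison` (kernel instance: companion
file, once that module is built).

## Content (`π` finite, `κ, κ'` Markov with `IsAdjointPair κ κ' π`; observables bounded measurable)

* **`integral_kop_mul_comm_of_isAdjointPair`** — `∫ (kop κ f) g dπ = ∫ f (kop κ' g) dπ`;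
  `integral_iterate_kop_mul_comm_of_isAdjointPair` — the same for every iterate `t`;
* **`autocov_eq_of_isAdjointPair`** — `autocov κ π g t = autocov κ' π g t` for every `t`, hence
  `autocov_fun_eq_of_isAdjointPair` (equality of the two functions) and **`tauInt_eq_of_isAdjointPair`**
  (`Scoring.tauInt` of the normalised autocorrelations coincide), `integral_mul_kop_eq_of_isAdjointPair`
  (`∫ v (kop κ v) dπ = ∫ v (kop κ' v) dπ`: equal Dirichlet forms);
* `kop_mixtureKernel` — `kop (mixtureKernel t κ η) f = t·kop κ f + (1 − t)·kop η f` (bounded measurable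
  `f`); **`isReversible_mixtureKernel_of_isAdjointPair`** — for `t = ½` the mixture of an adjoint pair is
  `π`-REVERSIBLE; **`integral_mul_kop_mixtureKernel_of_isAdjointPair`** — and has the Dirichlet form of
  `κ`: `∫ v (kop (mixtureKernel t κ κ') v) dπ = ∫ v (kop κ v) dπ`;
* sweeps: **`autocov_cycle_reverse_eq`** — for every list of `π`-reversible Markov kernels and every
  bounded measurable `g`, `autocov (cycle Ks) π g t = autocov (cycle Ks.reverse) π g t` for all `t`, and
  `tauInt_cycle_reverse_eq`.

NOT CLAIMED: cross-covariances of two observables (they DO depend on the direction); anything about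
mixing times; unbounded observables; any number of ours.
-/

noncomputable section

namespace Summit.Ventures.LatticeQCDFlow.Scoring

open MeasureTheory ProbabilityTheory Filter Finset Summit.Ventures.LatticeQCDFlow.Exactness
  Summit.Ventures.LatticeQCDFlow.Scaling
open scoped ENNReal

variable {Ω : Type*} [MeasurableSpace Ω]

/-! ### §1 Adjointness on observables -/

section Adjoint

variable {κ κ' : Kernel Ω Ω} [IsMarkovKernel κ] [IsMarkovKernel κ'] {π : Measure Ω} [IsFiniteMeasure π]

/-- **Adjointness on observables.**  If `(κ, κ')` is a `π`-adjoint pair of Markov kernels (`π` finite),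
then `∫ (kop κ f) · g dπ = ∫ f · (kop κ' g) dπ` for all bounded measurable `f, g`
(`IsAdjointPair.compProd_swap` + Fubini for the composition product). -/
theorem integral_kop_mul_comm_of_isAdjointPair (h : IsAdjointPair κ κ' π) {f g : Ω → ℝ}
    (hf : Measurable f) (hg : Measurable g) {Bf Bg : ℝ} (hBf : ∀ x, |f x| ≤ Bf)
    (hBg : ∀ x, |g x| ≤ Bg) :
    ∫ x, kop κ f x * g x ∂π = ∫ x, f x * kop κ' g x ∂π := by
  have hswap : (π ⊗ₘ κ').map Prod.swap = π ⊗ₘ κ := h.compProd_swap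
  have hFm : Measurable fun p : Ω × Ω => g p.1 * f p.2 :=
    (hg.comp measurable_fst).mul (hf.comp measurable_snd)
  have hFb : ∀ p : Ω × Ω, |g p.1 * f p.2| ≤ Bg * Bf := fun p => by
    rw [abs_mul]
    exact mul_le_mul (hBg _) (hBf _) (abs_nonneg _) ((abs_nonneg _).trans (hBg p.1))
  have hGm : Measurable fun p : Ω × Ω => g p.2 * f p.1 :=
    (hg.comp measurable_snd).mul (hf.comp measurable_fst)
  have hGb : ∀ p : Ω × Ω, |g p.2 * f p.1| ≤ Bg * Bf := fun p => by
    rw [abs_mul]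
    exact mul_le_mul (hBg _) (hBf _) (abs_nonneg _) ((abs_nonneg _).trans (hBg p.2))
  have hFi : Integrable (fun p : Ω × Ω => g p.1 * f p.2) (π ⊗ₘ κ) := integrable_of_bounded _ hFm hFb
  have hGi : Integrable (fun p : Ω × Ω => g p.2 * f p.1) (π ⊗ₘ κ') := integrable_of_bounded _ hGm hGb
  calc ∫ x, kop κ f x * g x ∂π = ∫ x, ∫ y, g x * f y ∂(κ x) ∂π := by
        refine integral_congr_ae (ae_of_all _ fun x => ?_)
        show kop κ f x * g x = ∫ y, g x * f y ∂(κ x)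
        rw [integral_const_mul, mul_comm]
        rfl
    _ = ∫ p, g p.1 * f p.2 ∂(π ⊗ₘ κ) := (Measure.integral_compProd hFi).symm
    _ = ∫ p, g p.1 * f p.2 ∂((π ⊗ₘ κ').map Prod.swap) := by rw [hswap]
    _ = ∫ p, g p.2 * f p.1 ∂(π ⊗ₘ κ') :=
        integral_map measurable_swap.aemeasurable hFm.aestronglyMeasurable
    _ = ∫ x, ∫ y, g y * f x ∂(κ' x) ∂π := Measure.integral_compProd hGi
    _ = ∫ x, f x * kop κ' g x ∂π := by
        refine integral_congr_ae (ae_of_all _ fun x => ?_)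
        show ∫ y, g y * f x ∂(κ' x) = f x * kop κ' g x
        rw [integral_mul_const, mul_comm]
        rfl

/-- **Iterates**: `∫ ((kop κ)^[t] f) · g dπ = ∫ f · ((kop κ')^[t] g) dπ` for every `t`. -/
theorem integral_iterate_kop_mul_comm_of_isAdjointPair (h : IsAdjointPair κ κ' π) :
    ∀ (t : ℕ) {f g : Ω → ℝ}, Measurable f → Measurable g → ∀ {Bf Bg : ℝ}, (∀ x, |f x| ≤ Bf) →
      (∀ x, |g x| ≤ Bg) →
      ∫ x, (kop κ)^[t] f x * g x ∂π = ∫ x, f x * (kop κ')^[t] g x ∂π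
  | 0, _, _, _, _, _, _, _, _ => by simp
  | t + 1, f, g, hf, hg, Bf, Bg, hBf, hBg => by
    rw [Function.iterate_succ_apply, Function.iterate_succ_apply',
      integral_iterate_kop_mul_comm_of_isAdjointPair h t (measurable_kop κ hf) hg (abs_kop_le κ hBf) hBg]
    obtain ⟨hgm, hgb⟩ := iterate_kop_bounded_measurable κ' hg hBg t
    exact integral_kop_mul_comm_of_isAdjointPair h hf hgm hBf hgb

/-- **TIME REVERSAL DOES NOT CHANGE AUTOCOVARIANCES**: `autocov κ π g t = autocov κ' π g t` for every
bounded measurable `g` and every lag `t`. -/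
theorem autocov_eq_of_isAdjointPair (h : IsAdjointPair κ κ' π) {g : Ω → ℝ} (hg : Measurable g)
    {B : ℝ} (hB : ∀ x, |g x| ≤ B) (t : ℕ) :
    autocov κ π g t = autocov κ' π g t := by
  unfold autocov
  have e : ∫ x, g x * (kop κ)^[t] g x ∂π = ∫ x, (kop κ)^[t] g x * g x ∂π :=
    integral_congr_ae (ae_of_all _ fun x => by ring)
  rw [e, integral_iterate_kop_mul_comm_of_isAdjointPair h t hg hg hB hB]

/-- The two autocovariance FUNCTIONS coincide (so do `ρ(t)`, the `Γ`-windows, the Green–Kubo sums). -/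
theorem autocov_fun_eq_of_isAdjointPair (h : IsAdjointPair κ κ' π) {g : Ω → ℝ} (hg : Measurable g)
    {B : ℝ} (hB : ∀ x, |g x| ≤ B) :
    autocov κ π g = autocov κ' π g :=
  funext fun t => autocov_eq_of_isAdjointPair h hg hB t

/-- **Equal `τ_int`** (`Scoring.tauInt` of the normalised autocorrelations) for a kernel and its adjoint. -/
theorem tauInt_eq_of_isAdjointPair (h : IsAdjointPair κ κ' π) {g : Ω → ℝ} (hg : Measurable g)
    {B : ℝ} (hB : ∀ x, |g x| ≤ B) :
    tauInt (fun t => autocov κ π g t / autocov κ π g 0)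
      = tauInt (fun t => autocov κ' π g t / autocov κ' π g 0) := by
  rw [autocov_fun_eq_of_isAdjointPair h hg hB]

/-- **Equal Dirichlet forms**: `∫ v (kop κ v) dπ = ∫ v (kop κ' v) dπ` (the lag-one case). -/
theorem integral_mul_kop_eq_of_isAdjointPair (h : IsAdjointPair κ κ' π) {v : Ω → ℝ} (hv : Measurable v)
    {B : ℝ} (hB : ∀ x, |v x| ≤ B) :
    ∫ x, v x * kop κ v x ∂π = ∫ x, v x * kop κ' v x ∂π := by
  have := autocov_eq_of_isAdjointPair h hv hB 1
  simpa only [autocov, Function.iterate_one] using this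

end Adjoint

/-! ### §2 The additive reversibilization `½(κ + κ†)` as a kernel -/

section Mixture

variable {κ η : Kernel Ω Ω} [IsMarkovKernel κ] [IsMarkovKernel η] {π : Measure Ω}

/-- **`kop` of a mixture**: `kop (mixtureKernel t κ η) f = t · kop κ f + (1 − t) · kop η f` pointwise,
for bounded measurable `f`. -/
theorem kop_mixtureKernel (t : unitInterval) {f : Ω → ℝ} (hf : Measurable f) {B : ℝ}
    (hB : ∀ x, |f x| ≤ B) (x : Ω) :
    kop (mixtureKernel t κ η) f x = (t : ℝ) * kop κ f x + (1 - (t : ℝ)) * kop η f x := by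
  unfold kop
  show ∫ y, f y ∂(mixtureMeasure t κ η x) = _
  simp only [mixtureMeasure]
  rw [integral_add_measure ((integrable_of_bounded _ hf hB).smul_measure ENNReal.ofReal_ne_top)
      ((integrable_of_bounded _ hf hB).smul_measure ENNReal.ofReal_ne_top),
    integral_smul_measure, integral_smul_measure, ENNReal.toReal_ofReal t.2.1,
    ENNReal.toReal_ofReal (sub_nonneg.2 t.2.2), smul_eq_mul, smul_eq_mul]

omit [IsMarkovKernel κ] in
/-- **THE FAIR MIXTURE OF AN ADJOINT PAIR IS REVERSIBLE**: for `(t : ℝ) = ½`,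
`mixtureKernel t κ κ'` (`= ½(κ + κ†)`, the additive reversibilization) is `π`-reversible. -/
theorem isReversible_mixtureKernel_of_isAdjointPair {κ' : Kernel Ω Ω} (h : IsAdjointPair κ κ' π)
    (t : unitInterval) (ht : (t : ℝ) = 1 / 2) :
    Kernel.IsReversible (mixtureKernel t κ κ') π := by
  intro A B hA hB
  simp only [mixtureKernel_apply']
  have hmB : Measurable fun z => ENNReal.ofReal (t : ℝ) * κ z B := (κ.measurable_coe hB).const_mul _
  have hmA : Measurable fun z => ENNReal.ofReal (t : ℝ) * κ z A := (κ.measurable_coe hA).const_mul _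
  have ht' : (1 : ℝ) - (t : ℝ) = (t : ℝ) := by rw [ht]; norm_num
  rw [lintegral_add_left hmB, lintegral_add_left hmA, lintegral_const_mul _ (κ.measurable_coe hB),
    lintegral_const_mul _ (κ'.measurable_coe hB), lintegral_const_mul _ (κ.measurable_coe hA),
    lintegral_const_mul _ (κ'.measurable_coe hA), ht', h hA hB, ← h.symm hA hB, add_comm]

variable [IsFiniteMeasure π]

/-- **The additive reversibilization has the Dirichlet form of `κ`**: for an adjoint pair and ANY
`t ∈ [0,1]`, `∫ v (kop (mixtureKernel t κ κ') v) dπ = ∫ v (kop κ v) dπ` (bounded measurable `v`). -/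
theorem integral_mul_kop_mixtureKernel_of_isAdjointPair {κ' : Kernel Ω Ω} [IsMarkovKernel κ']
    (h : IsAdjointPair κ κ' π) (t : unitInterval) {v : Ω → ℝ} (hv : Measurable v) {B : ℝ}
    (hB : ∀ x, |v x| ≤ B) :
    ∫ x, v x * kop (mixtureKernel t κ κ') v x ∂π = ∫ x, v x * kop κ v x ∂π := by
  have e : ∀ x, v x * kop (mixtureKernel t κ κ') v x
      = (t : ℝ) * (v x * kop κ v x) + (1 - (t : ℝ)) * (v x * kop κ' v x) := fun x => by
    rw [kop_mixtureKernel t hv hB]; ring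
  simp_rw [e]
  have i1 : Integrable (fun x => v x * kop κ v x) π :=
    integrable_of_bounded π (hv.mul (measurable_kop κ hv)) (C := |B| * B) fun x => by
      rw [abs_mul]
      exact mul_le_mul ((hB x).trans (le_abs_self B)) (abs_kop_le κ hB x) (abs_nonneg _) (abs_nonneg _)
  have i2 : Integrable (fun x => v x * kop κ' v x) π :=
    integrable_of_bounded π (hv.mul (measurable_kop κ' hv)) (C := |B| * B) fun x => by
      rw [abs_mul]
      exact mul_le_mul ((hB x).trans (le_abs_self B)) (abs_kop_le κ' hB x) (abs_nonneg _) (abs_nonneg _)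
  rw [integral_add (i1.const_mul _) (i2.const_mul _), integral_const_mul, integral_const_mul,
    ← integral_mul_kop_eq_of_isAdjointPair h hv hB]
  ring

omit [IsFiniteMeasure π] in
/-- The additive reversibilization leaves `π` invariant (any `t`; both members of the pair do). -/
theorem invariant_mixtureKernel_of_isAdjointPair {κ' : Kernel Ω Ω} [IsMarkovKernel κ']
    (h : IsAdjointPair κ κ' π) (t : unitInterval) :
    Kernel.Invariant (mixtureKernel t κ κ') π :=
  invariant_mixtureKernel t h.invariant h.symm.invariant

end Mixture

/-! ### §3 Sweeps: the reversed cycle of reversible updates has the same autocorrelations -/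

section Sweeps

variable {π : Measure Ω} [IsFiniteMeasure π]

/-- **FORWARD AND BACKWARD SWEEPS SCORE IDENTICALLY**: for every list `Ks` of `π`-reversible Markov
kernels, every bounded measurable `g` and every lag `t`,
`autocov (cycle Ks) π g t = autocov (cycle Ks.reverse) π g t`. -/
theorem autocov_cycle_reverse_eq {Ks : List (Kernel Ω Ω)} (hM : ∀ κ ∈ Ks, IsMarkovKernel κ)
    (hrev : ∀ κ ∈ Ks, Kernel.IsReversible κ π) {g : Ω → ℝ} (hg : Measurable g) {B : ℝ}
    (hB : ∀ x, |g x| ≤ B) (t : ℕ) :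
    autocov (cycle Ks) π g t = autocov (cycle Ks.reverse) π g t := by
  haveI := isMarkovKernel_cycle hM
  haveI : IsMarkovKernel (cycle Ks.reverse) :=
    isMarkovKernel_cycle fun η hη => hM η (List.mem_reverse.mp hη)
  exact autocov_eq_of_isAdjointPair (isAdjointPair_cycle_reverse hM hrev) hg hB t

/-- **Equal `τ_int` for the forward and the backward sweep** of reversible updates, every observable. -/
theorem tauInt_cycle_reverse_eq {Ks : List (Kernel Ω Ω)} (hM : ∀ κ ∈ Ks, IsMarkovKernel κ)
    (hrev : ∀ κ ∈ Ks, Kernel.IsReversible κ π) {g : Ω → ℝ} (hg : Measurable g) {B : ℝ}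
    (hB : ∀ x, |g x| ≤ B) :
    tauInt (fun t => autocov (cycle Ks) π g t / autocov (cycle Ks) π g 0)
      = tauInt (fun t => autocov (cycle Ks.reverse) π g t / autocov (cycle Ks.reverse) π g 0) := by
  haveI := isMarkovKernel_cycle hM
  haveI : IsMarkovKernel (cycle Ks.reverse) :=
    isMarkovKernel_cycle fun η hη => hM η (List.mem_reverse.mp hη)
  exact tauInt_eq_of_isAdjointPair (isAdjointPair_cycle_reverse hM hrev) hg hB

/-- **The direction-randomised sweep is reversible with the forward sweep's Dirichlet form**: with
`σ = mixtureKernel t (cycle Ks) (cycle Ks.reverse)`, `(t : ℝ) = ½` (flip a fair coin, then sweep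
forward or backward), `σ` is `π`-reversible and `∫ v (kop σ v) dπ = ∫ v (kop (cycle Ks) v) dπ`. -/
theorem cycle_directionMixture_isReversible_and_form {Ks : List (Kernel Ω Ω)}
    (hM : ∀ κ ∈ Ks, IsMarkovKernel κ) (hrev : ∀ κ ∈ Ks, Kernel.IsReversible κ π)
    (t : unitInterval) (ht : (t : ℝ) = 1 / 2) {v : Ω → ℝ} (hv : Measurable v) {B : ℝ}
    (hB : ∀ x, |v x| ≤ B) :
    Kernel.IsReversible (mixtureKernel t (cycle Ks) (cycle Ks.reverse)) π ∧
      (haveI := isMarkovKernel_cycle hM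
       haveI : IsMarkovKernel (cycle Ks.reverse) :=
         isMarkovKernel_cycle fun η hη => hM η (List.mem_reverse.mp hη)
       ∫ x, v x * kop (mixtureKernel t (cycle Ks) (cycle Ks.reverse)) v x ∂π
         = ∫ x, v x * kop (cycle Ks) v x ∂π) := by
  haveI := isMarkovKernel_cycle hM
  haveI : IsMarkovKernel (cycle Ks.reverse) :=
    isMarkovKernel_cycle fun η hη => hM η (List.mem_reverse.mp hη)
  have hadj := isAdjointPair_cycle_reverse hM hrev
  exact ⟨isReversible_mixtureKernel_of_isAdjointPair hadj t ht,
    integral_mul_kop_mixtureKernel_of_isAdjointPair hadj t hv hB⟩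

end Sweeps

end Summit.Ventures.LatticeQCDFlow.Scoring
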